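import Mathlib
import HarnessLib
import Summits.Ventures.LatticeQCDFlow.Scoring.ChainBlockAverages
import Summits.Ventures.LatticeQCDFlow.Scoring.ChainPathLaw
import Summits.Ventures.LatticeQCDFlow.Scoring.ChainBurnIn
import Summits.Ventures.LatticeQCDFlow.Scoring.SplitChainFreshPairMoments

/-!
# Averages along the `b`-skeleton `X_0, X_b, X_{2b}, …` of a chain with a geometric envelope, from
# any start: `E_{μ₀}|(1/a) Σ_{j<a} g(X_{bj}) − π g| ≤ 2C_g/a + 2 C_g A ρ^b + 2 C_g/√(a−1)`

HONEST FRAMING: exact (Metropolis-corrected) sampling algorithms for lattice gauge theory;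
figures of merit are autocorrelation/cost numbers at stated couplings and volumes; no
continuum-physics claim.

Venture `LatticeQCDFlow` (cell pub-lqcd), topic `Scoring`; FANOUT row 4 (`s0-u1-b`, GEN-30).
NEW WORK of the cell, not a published result; no definition is introduced; nothing is cited as a
fact.  The batch-means estimator with `a` batches of length `b` carries block-boundary terms that
are sums along the `b`-SKELETON of the chain (the batch starts `X_{bj}`); at the `√a` scale of its
CLT they contribute a deterministic `O(√a/b)` shift plus a fluctuation which this file controls in
EVERY regime `a, b → ∞` (no relation between `a` and `b` beyond `√a ρ^b → 0` downstream).  The tool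
is the cell's block law of large numbers (`Scoring/ChainBlockAverages.chain_blockAverage_abs_sub_integral_le`:
conditionally centred blocks are orthogonal) applied to the one-coordinate block functionals
`Ψ(y) = g(y_b)` — whose block mean from state `z` is `((kop κ)^b g)(z)`, within `2 C_g A ρ^b` of
`π g` by the envelope — and `Ψ(y) = h(y_0) h(y_b)` for a `π`-centred `h`, whose block mean
`h(z) ((kop κ)^b h)(z)` is within `2 C_h² A ρ^b` of `0`.

## Content

* `chain_dirac_integral_eval_eq_iterate_kop` — `E_z[g(X_t)] = ((kop κ)^t g)(z)`;
* `chain_dirac_integral_mul_eval_eq` — `E_z[h(X_0) g(X_t)] = h(z) ((kop κ)^t g)(z)`;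
* **`chain_skeletonAverage_shift_abs_sub_le_of_envelope`** — `a ≥ 1`:
  `E_{μ₀}|(1/a) Σ_{j<a} g(X_{bj+b}) − π g| ≤ 2 C_g A ρ^b + 2 √(C_g²/a)`;
* **`chain_skeletonAverage_abs_sub_le_of_envelope`** — `a ≥ 2`:
  `E_{μ₀}|(1/a) Σ_{j<a} g(X_{bj}) − π g| ≤ 2 C_g/a + 2 C_g A ρ^b + 2 √(C_g²/(a−1))`;
* **`chain_skeletonCross_abs_le_of_envelope`** — `π h = 0`, `a ≥ 1`:
  `E_{μ₀}|(1/a) Σ_{j<a} h(X_{bj}) h(X_{bj+b})| ≤ 2 C_h² A ρ^b + 2 √(C_h⁴/a)`.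

NOT CLAIMED: almost-sure versions; rates beyond `L¹`.
-/

noncomputable section

namespace Summit.Ventures.LatticeQCDFlow.Scoring

open MeasureTheory ProbabilityTheory Filter Finset Preorder
open scoped ENNReal Topology

variable {Ω : Type*} [MeasurableSpace Ω]
variable (κ : Kernel Ω Ω) [IsMarkovKernel κ]

/-- `E_z[g(X_t)] = ((kop κ)^t g)(z)` for the chain started at `δ_z`. -/
theorem chain_dirac_integral_eval_eq_iterate_kop (z : Ω) {g : Ω → ℝ} (hg : Measurable g) {Cg : ℝ}
    (hCg : ∀ x, |g x| ≤ Cg) (t : ℕ) :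
    ∫ y, g (y t) ∂(Kernel.trajMeasure (X := fun _ : ℕ => Ω) (Measure.dirac z)
          (fun n : ℕ => κ.comap (fun h' : (i : ↥(Finset.Iic n)) → Ω => h' ⟨n, Finset.mem_Iic.2
                le_rfl⟩)
            (measurable_pi_apply _))) = (kop κ)^[t] g z := by
  have h1 := chain_tower_iterate κ (Measure.dirac z) 0 (F := fun _ => (1 : ℝ)) measurable_const
    (CF := 1) (fun _ => by simp) t hg hCg
  simp only [one_mul, zero_add] at h1
  rw [h1]
  obtain ⟨hgm, -⟩ := iterate_kop_bounded_measurable κ hg hCg t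
  rw [chain_initial κ (Measure.dirac z) hgm, integral_dirac' _ _ hgm.stronglyMeasurable]

/-- `E_z[h(X_0) g(X_t)] = h(z) ((kop κ)^t g)(z)` for the chain started at `δ_z`. -/
theorem chain_dirac_integral_mul_eval_eq (z : Ω) {h : Ω → ℝ} (hh : Measurable h) {Ch : ℝ}
    (hCh : ∀ x, |h x| ≤ Ch) {g : Ω → ℝ} (hg : Measurable g) {Cg : ℝ} (hCg : ∀ x, |g x| ≤ Cg)
    (t : ℕ) :
    ∫ y, h (y 0) * g (y t) ∂(Kernel.trajMeasure (X := fun _ : ℕ => Ω) (Measure.dirac z)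
          (fun n : ℕ => κ.comap (fun h' : (i : ↥(Finset.Iic n)) → Ω => h' ⟨n, Finset.mem_Iic.2
                le_rfl⟩)
            (measurable_pi_apply _))) = h z * (kop κ)^[t] g z := by
  have h1 := chain_tower_iterate κ (Measure.dirac z) 0
    (F := fun w : (i : ↥(Finset.Iic 0)) → Ω => h (w ⟨0, Finset.mem_Iic.2 le_rfl⟩))
    (hh.comp (measurable_pi_apply _)) (CF := Ch) (fun w => hCh _) t hg hCg
  simp only [zero_add] at h1
  have e : ∀ y : ℕ → Ω, h (frestrictLe (π := fun _ : ℕ => Ω) 0 y ⟨0, Finset.mem_Iic.2 le_rfl⟩)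
      = h (y 0) := fun y => rfl
  simp only [e] at h1
  rw [h1]
  obtain ⟨hgm, hgb⟩ := iterate_kop_bounded_measurable κ hg hCg t
  have hm : Measurable fun w => h w * (kop κ)^[t] g w := hh.mul hgm
  rw [chain_initial κ (Measure.dirac z) hm, integral_dirac' _ _ hm.stronglyMeasurable]

variable {κ}
variable {π : Measure Ω} [IsProbabilityMeasure π] {A ρ : ℝ}

omit [IsProbabilityMeasure π] in
/-- **SKELETON AVERAGES, SHIFTED BY ONE BLOCK.**  Envelope `(A, ρ)`, `|g| ≤ C_g` measurable,
`a ≥ 1`; for every initial law: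
`E_{μ₀}|(1/a) Σ_{j<a} g(X_{bj+b}) − π g| ≤ 2 C_g A ρ^b + 2 √(C_g²/a)`. -/
theorem chain_skeletonAverage_shift_abs_sub_le_of_envelope
    (henv : ∀ (g : Ω → ℝ), Measurable g → ∀ (Cg : ℝ), (∀ x, |g x| ≤ Cg) →
      ∀ (t : ℕ) (x : Ω), |(kop κ)^[t] g x - ∫ y, g y ∂π| ≤ 2 * Cg * (A * ρ ^ t))
    {g : Ω → ℝ} (hg : Measurable g) {Cg : ℝ} (hCg : ∀ x, |g x| ≤ Cg)
    (μ₀ : Measure Ω) [IsProbabilityMeasure μ₀] {a : ℕ} (ha : 0 < a) (b : ℕ) :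
    ∫ x, |(∑ j ∈ Finset.range a, g (x (b * j + b))) / a - ∫ y, g y ∂π| ∂(Kernel.trajMeasure (X :=
          fun _ : ℕ => Ω) (μ₀)
          (fun n : ℕ => κ.comap (fun h' : (i : ↥(Finset.Iic n)) → Ω => h' ⟨n, Finset.mem_Iic.2
                le_rfl⟩)
            (measurable_pi_apply _)))
      ≤ 2 * Cg * (A * ρ ^ b) + 2 * Real.sqrt (Cg ^ 2 / a) := by
  have hΨm : Measurable fun y : ℕ → Ω => g (y b) := hg.comp (measurable_pi_apply _)
  have hΨd : DependsOn (fun y : ℕ → Ω => g (y b)) (Set.Iic b) := by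
    intro x y hxy
    show g (x b) = g (y b)
    rw [hxy b (Set.mem_Iic.2 le_rfl)]
  have hΨb : ∀ y : ℕ → Ω, |g (y b)| ≤ Cg := fun y => hCg _
  have hmean : ∀ z : Ω, |∫ y, g (y b) ∂(Kernel.trajMeasure (X := fun _ : ℕ => Ω) (Measure.dirac z)
        (fun n : ℕ => κ.comap (fun h' : (i : ↥(Finset.Iic n)) → Ω => h' ⟨n, Finset.mem_Iic.2
              le_rfl⟩)
          (measurable_pi_apply _))) - ∫ y, g y ∂π| ≤ 2 * Cg * (A * ρ ^ b) := by
    intro z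
    rw [chain_dirac_integral_eval_eq_iterate_kop κ z hg hCg b]
    exact henv g hg Cg hCg b z
  have hV : ∀ z : Ω, ∫ y, g (y b) ^ 2 ∂(Kernel.trajMeasure (X := fun _ : ℕ => Ω) (Measure.dirac z)
        (fun n : ℕ => κ.comap (fun h' : (i : ↥(Finset.Iic n)) → Ω => h' ⟨n, Finset.mem_Iic.2
              le_rfl⟩)
          (measurable_pi_apply _))) ≤ Cg ^ 2 := by
    intro z
    have hpt : ∀ y : ℕ → Ω, g (y b) ^ 2 ≤ Cg ^ 2 := fun y => by
      rw [← sq_abs]; exact pow_le_pow_left₀ (abs_nonneg _) (hCg _) 2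
    calc ∫ y, g (y b) ^ 2 ∂(Kernel.trajMeasure (X := fun _ : ℕ => Ω) (Measure.dirac z)
          (fun n : ℕ => κ.comap (fun h' : (i : ↥(Finset.Iic n)) → Ω => h' ⟨n, Finset.mem_Iic.2
                le_rfl⟩)
            (measurable_pi_apply _))) ≤ ∫ y, Cg ^ 2 ∂(Kernel.trajMeasure (X := fun _ : ℕ => Ω)
                  (Measure.dirac z)
          (fun n : ℕ => κ.comap (fun h' : (i : ↥(Finset.Iic n)) → Ω => h' ⟨n, Finset.mem_Iic.2
                le_rfl⟩)
            (measurable_pi_apply _))) :=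
          integral_mono_of_nonneg (ae_of_all _ fun y => sq_nonneg _) (integrable_const _)
            (ae_of_all _ hpt)
      _ = Cg ^ 2 := by rw [integral_const, probReal_univ, one_smul]
  have hLLN := chain_blockAverage_abs_sub_integral_le κ μ₀ hΨm hΨd hΨb hmean hV ha
  exact hLLN

/-- **SKELETON AVERAGES.**  Envelope `(A, ρ)`, `|g| ≤ C_g` measurable, `a ≥ 2`; for every initial
law: `E_{μ₀}|(1/a) Σ_{j<a} g(X_{bj}) − π g| ≤ 2 C_g/a + 2 C_g A ρ^b + 2 √(C_g²/(a−1))`. -/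
theorem chain_skeletonAverage_abs_sub_le_of_envelope
    (henv : ∀ (g : Ω → ℝ), Measurable g → ∀ (Cg : ℝ), (∀ x, |g x| ≤ Cg) →
      ∀ (t : ℕ) (x : Ω), |(kop κ)^[t] g x - ∫ y, g y ∂π| ≤ 2 * Cg * (A * ρ ^ t))
    {g : Ω → ℝ} (hg : Measurable g) {Cg : ℝ} (hCg : ∀ x, |g x| ≤ Cg)
    (μ₀ : Measure Ω) [IsProbabilityMeasure μ₀] {a : ℕ} (ha : 2 ≤ a) (b : ℕ) :
    ∫ x, |(∑ j ∈ Finset.range a, g (x (b * j))) / a - ∫ y, g y ∂π| ∂(Kernel.trajMeasure (X := fun _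
          : ℕ => Ω) (μ₀)
          (fun n : ℕ => κ.comap (fun h' : (i : ↥(Finset.Iic n)) → Ω => h' ⟨n, Finset.mem_Iic.2
                le_rfl⟩)
            (measurable_pi_apply _)))
      ≤ 2 * Cg / a + 2 * Cg * (A * ρ ^ b) + 2 * Real.sqrt (Cg ^ 2 / ((a : ℝ) - 1)) := by
  set P := (Kernel.trajMeasure (X := fun _ : ℕ => Ω) (μ₀)
        (fun n : ℕ => κ.comap (fun h' : (i : ↥(Finset.Iic n)) → Ω => h' ⟨n, Finset.mem_Iic.2
              le_rfl⟩)
          (measurable_pi_apply _))) with hP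
  obtain ⟨x0⟩ := nonempty_of_isProbabilityMeasure μ₀
  have hCg0 : 0 ≤ Cg := (abs_nonneg _).trans (hCg x0)
  obtain ⟨hgbm, hgb, -⟩ := centred_observable_bounds π hg hCg
  have haR : (0 : ℝ) < a := by exact_mod_cast (show 0 < a by omega)
  have ha1 : (0 : ℝ) < (a : ℝ) - 1 := by
    have : (2 : ℝ) ≤ a := by exact_mod_cast ha
    linarith
  -- split off the first point of the skeleton
  obtain ⟨a', rfl⟩ : ∃ a', a = a' + 1 := ⟨a - 1, by omega⟩
  have ha' : 0 < a' := by omega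
  have ha'R : ((a' + 1 : ℕ) : ℝ) - 1 = (a' : ℝ) := by push_cast; ring
  rw [ha'R]
  have hsplit : ∀ x : ℕ → Ω, (∑ j ∈ Finset.range (a' + 1), g (x (b * j))) / ((a' + 1 : ℕ) : ℝ) - ∫
        y, g y ∂π
      = (g (x 0) - ∫ y, g y ∂π) / ((a' + 1 : ℕ) : ℝ)
        + ((a' : ℝ) / ((a' + 1 : ℕ) : ℝ))
          * ((∑ j ∈ Finset.range a', g (x (b * j + b))) / a' - ∫ y, g y ∂π) := by
    intro x
    rw [Finset.sum_range_succ']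
    simp only [mul_zero, Nat.mul_succ]
    have ha'ne : (a' : ℝ) ≠ 0 := by exact_mod_cast ha'.ne'
    have ha1ne : ((a' + 1 : ℕ) : ℝ) ≠ 0 := by positivity
    field_simp
    push_cast
    ring
  simp_rw [hsplit]
  -- the two pieces
  have h1m : Measurable fun x : ℕ → Ω => (g (x 0) - ∫ y, g y ∂π) / ((a' + 1 : ℕ) : ℝ) :=
    (hgbm.comp (measurable_pi_apply 0)).div_const _
  have h2m : Measurable fun x : ℕ → Ω => ((a' : ℝ) / ((a' + 1 : ℕ) : ℝ))
      * ((∑ j ∈ Finset.range a', g (x (b * j + b))) / a' - ∫ y, g y ∂π) :=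
    (((Finset.measurable_sum _ fun j _ => hg.comp (measurable_pi_apply _)).div_const _).sub_const
      _).const_mul _
  have h2b : ∀ x : ℕ → Ω, |(∑ j ∈ Finset.range a', g (x (b * j + b))) / a' - ∫ y, g y ∂π| ≤ Cg + Cg
        := by
    intro x
    have ha'R : (0 : ℝ) < a' := by exact_mod_cast ha'
    refine (abs_sub _ _).trans (add_le_add ?_ ?_)
    · rw [abs_div, abs_of_pos ha'R, div_le_iff₀ ha'R]
      calc |∑ j ∈ Finset.range a', g (x (b * j + b))| ≤ ∑ j ∈ Finset.range a', |g (x (b * j + b))|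
            :=
            Finset.abs_sum_le_sum_abs _ _
        _ ≤ ∑ _j ∈ Finset.range a', Cg := Finset.sum_le_sum fun j _ => hCg _
        _ = Cg * a' := by rw [Finset.sum_const, Finset.card_range, nsmul_eq_mul, mul_comm]
    · have := centred_observable_bounds π hg hCg
      calc |∫ y, g y ∂π| = ‖∫ y, g y ∂π‖ := (Real.norm_eq_abs _).symm
        _ ≤ Cg * π.real Set.univ := norm_integral_le_of_norm_le_const (Eventually.of_forall fun y =>
            by rw [Real.norm_eq_abs]; exact hCg y)
        _ = Cg := by rw [probReal_univ, mul_one]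
  have hi1 : Integrable (fun x : ℕ → Ω => |(g (x 0) - ∫ y, g y ∂π) / ((a' + 1 : ℕ) : ℝ)|) P :=
    (integrable_of_bounded P h1m (C := 2 * Cg / ((a' + 1 : ℕ) : ℝ)) fun x => by
      rw [abs_div, abs_of_pos haR]; exact div_le_div_of_nonneg_right (hgb _) haR.le).abs
  have hi2 : Integrable (fun x : ℕ → Ω => |((a' : ℝ) / ((a' + 1 : ℕ) : ℝ))
      * ((∑ j ∈ Finset.range a', g (x (b * j + b))) / a' - ∫ y, g y ∂π)|) P :=
    (integrable_of_bounded P h2m (C := (a' : ℝ) / ((a' + 1 : ℕ) : ℝ) * (Cg + Cg)) fun x => by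
      rw [abs_mul, abs_of_nonneg (by positivity)]
      exact mul_le_mul_of_nonneg_left (h2b x) (by positivity)).abs
  have hstep : ∫ x, |(g (x 0) - ∫ y, g y ∂π) / ((a' + 1 : ℕ) : ℝ)
        + ((a' : ℝ) / ((a' + 1 : ℕ) : ℝ))
          * ((∑ j ∈ Finset.range a', g (x (b * j + b))) / a' - ∫ y, g y ∂π)| ∂P
      ≤ ∫ x, (|(g (x 0) - ∫ y, g y ∂π) / ((a' + 1 : ℕ) : ℝ)|
        + |((a' : ℝ) / ((a' + 1 : ℕ) : ℝ))
          * ((∑ j ∈ Finset.range a', g (x (b * j + b))) / a' - ∫ y, g y ∂π)|) ∂P :=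
    integral_mono_of_nonneg (ae_of_all _ fun x => abs_nonneg _) (hi1.add hi2)
      (ae_of_all _ fun x => abs_add_le _ _)
  rw [integral_add hi1 hi2] at hstep
  -- first piece: `≤ 2 C_g / a`
  have hA1 : ∫ x, |(g (x 0) - ∫ y, g y ∂π) / ((a' + 1 : ℕ) : ℝ)| ∂P ≤ 2 * Cg / ((a' + 1 : ℕ) : ℝ)
        := by
    have hpt : ∀ x : ℕ → Ω, |(g (x 0) - ∫ y, g y ∂π) / ((a' + 1 : ℕ) : ℝ)| ≤ 2 * Cg / ((a' + 1 : ℕ)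
          : ℝ) :=
      fun x => by rw [abs_div, abs_of_pos haR]; exact div_le_div_of_nonneg_right (hgb _) haR.le
    calc ∫ x, |(g (x 0) - ∫ y, g y ∂π) / ((a' + 1 : ℕ) : ℝ)| ∂P
        ≤ ∫ x, 2 * Cg / ((a' + 1 : ℕ) : ℝ) ∂P :=
          integral_mono_of_nonneg (ae_of_all _ fun x => abs_nonneg _) (integrable_const _)
            (ae_of_all _ hpt)
      _ = 2 * Cg / ((a' + 1 : ℕ) : ℝ) := by rw [integral_const, probReal_univ, one_smul]
  -- second piece: the shifted skeleton average, weight `a'/(a'+1) ≤ 1`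
  have hA2 : ∫ x, |((a' : ℝ) / ((a' + 1 : ℕ) : ℝ))
      * ((∑ j ∈ Finset.range a', g (x (b * j + b))) / a' - ∫ y, g y ∂π)| ∂P
      ≤ 2 * Cg * (A * ρ ^ b) + 2 * Real.sqrt (Cg ^ 2 / a') := by
    have h2 := chain_skeletonAverage_shift_abs_sub_le_of_envelope (κ := κ) henv hg hCg μ₀ ha' b
    rw [← hP] at h2
    have hw : (a' : ℝ) / ((a' + 1 : ℕ) : ℝ) ≤ 1 := by
      rw [div_le_one haR]; push_cast; linarith
    have hw0 : 0 ≤ (a' : ℝ) / ((a' + 1 : ℕ) : ℝ) := by positivity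
    simp_rw [abs_mul, abs_of_nonneg hw0]
    rw [integral_const_mul]
    have hI0 : 0 ≤ ∫ x, |(∑ j ∈ Finset.range a', g (x (b * j + b))) / a' - ∫ y, g y ∂π| ∂P :=
      integral_nonneg fun x => abs_nonneg _
    calc (a' : ℝ) / ((a' + 1 : ℕ) : ℝ) * ∫ x, |(∑ j ∈ Finset.range a', g (x (b * j + b))) / a' - ∫
          y, g y ∂π| ∂P
        ≤ 1 * ∫ x, |(∑ j ∈ Finset.range a', g (x (b * j + b))) / a' - ∫ y, g y ∂π| ∂P :=
          mul_le_mul_of_nonneg_right hw hI0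
      _ ≤ 2 * Cg * (A * ρ ^ b) + 2 * Real.sqrt (Cg ^ 2 / a') := by rw [one_mul]; exact h2
  linarith [hstep, hA1, hA2]

omit [IsProbabilityMeasure π] in
/-- **SKELETON CROSS PRODUCTS ARE SMALL FOR A `π`-CENTRED FUNCTION.**  Envelope `(A, ρ)`,
`|h| ≤ C_h` measurable with `π h = 0`, `a ≥ 1`; for every initial law:
`E_{μ₀}|(1/a) Σ_{j<a} h(X_{bj}) h(X_{bj+b})| ≤ 2 C_h² A ρ^b + 2 √(C_h⁴/a)`. -/
theorem chain_skeletonCross_abs_le_of_envelope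
    (henv : ∀ (g : Ω → ℝ), Measurable g → ∀ (Cg : ℝ), (∀ x, |g x| ≤ Cg) →
      ∀ (t : ℕ) (x : Ω), |(kop κ)^[t] g x - ∫ y, g y ∂π| ≤ 2 * Cg * (A * ρ ^ t))
    {h : Ω → ℝ} (hh : Measurable h) {Ch : ℝ} (hCh : ∀ x, |h x| ≤ Ch) (hπh : ∫ y, h y ∂π = 0)
    (μ₀ : Measure Ω) [IsProbabilityMeasure μ₀] {a : ℕ} (ha : 0 < a) (b : ℕ) :
    ∫ x, |(∑ j ∈ Finset.range a, h (x (b * j)) * h (x (b * j + b))) / a| ∂(Kernel.trajMeasure (X :=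
          fun _ : ℕ => Ω) (μ₀)
          (fun n : ℕ => κ.comap (fun h' : (i : ↥(Finset.Iic n)) → Ω => h' ⟨n, Finset.mem_Iic.2
                le_rfl⟩)
            (measurable_pi_apply _)))
      ≤ 2 * Ch ^ 2 * (A * ρ ^ b) + 2 * Real.sqrt (Ch ^ 4 / a) := by
  obtain ⟨x0⟩ := nonempty_of_isProbabilityMeasure μ₀
  have hCh0 : 0 ≤ Ch := (abs_nonneg _).trans (hCh x0)
  have hΨm : Measurable fun y : ℕ → Ω => h (y 0) * h (y b) :=
    (hh.comp (measurable_pi_apply _)).mul (hh.comp (measurable_pi_apply _))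
  have hΨd : DependsOn (fun y : ℕ → Ω => h (y 0) * h (y b)) (Set.Iic b) := by
    intro x y hxy
    show h (x 0) * h (x b) = h (y 0) * h (y b)
    rw [hxy 0 (Set.mem_Iic.2 (Nat.zero_le _)), hxy b (Set.mem_Iic.2 le_rfl)]
  have hΨb : ∀ y : ℕ → Ω, |h (y 0) * h (y b)| ≤ Ch ^ 2 := fun y => by
    rw [abs_mul, sq]; exact mul_le_mul (hCh _) (hCh _) (abs_nonneg _) hCh0
  have hmean : ∀ z : Ω, |∫ y, h (y 0) * h (y b) ∂(Kernel.trajMeasure (X := fun _ : ℕ => Ω)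
        (Measure.dirac z)
        (fun n : ℕ => κ.comap (fun h' : (i : ↥(Finset.Iic n)) → Ω => h' ⟨n, Finset.mem_Iic.2
              le_rfl⟩)
          (measurable_pi_apply _))) - 0| ≤ 2 * Ch ^ 2 * (A * ρ ^ b) := by
    intro z
    rw [sub_zero, chain_dirac_integral_mul_eval_eq κ z hh hCh hh hCh b, abs_mul]
    have h1 := henv h hh Ch hCh b z
    rw [hπh, sub_zero] at h1
    calc |h z| * |(kop κ)^[b] h z| ≤ Ch * (2 * Ch * (A * ρ ^ b)) :=
          mul_le_mul (hCh z) h1 (abs_nonneg _) hCh0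
      _ = 2 * Ch ^ 2 * (A * ρ ^ b) := by ring
  have hV : ∀ z : Ω, ∫ y, (h (y 0) * h (y b)) ^ 2 ∂(Kernel.trajMeasure (X := fun _ : ℕ => Ω)
        (Measure.dirac z)
        (fun n : ℕ => κ.comap (fun h' : (i : ↥(Finset.Iic n)) → Ω => h' ⟨n, Finset.mem_Iic.2
              le_rfl⟩)
          (measurable_pi_apply _))) ≤ Ch ^ 4 := by
    intro z
    have hpt : ∀ y : ℕ → Ω, (h (y 0) * h (y b)) ^ 2 ≤ Ch ^ 4 := fun y => by
      rw [← sq_abs, show Ch ^ 4 = (Ch ^ 2) ^ 2 by ring]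
      exact pow_le_pow_left₀ (abs_nonneg _) (hΨb y) 2
    calc ∫ y, (h (y 0) * h (y b)) ^ 2 ∂(Kernel.trajMeasure (X := fun _ : ℕ => Ω) (Measure.dirac z)
          (fun n : ℕ => κ.comap (fun h' : (i : ↥(Finset.Iic n)) → Ω => h' ⟨n, Finset.mem_Iic.2
                le_rfl⟩)
            (measurable_pi_apply _))) ≤ ∫ y, Ch ^ 4 ∂(Kernel.trajMeasure (X := fun _ : ℕ => Ω)
                  (Measure.dirac z)
          (fun n : ℕ => κ.comap (fun h' : (i : ↥(Finset.Iic n)) → Ω => h' ⟨n, Finset.mem_Iic.2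
                le_rfl⟩)
            (measurable_pi_apply _))) :=
          integral_mono_of_nonneg (ae_of_all _ fun y => sq_nonneg _) (integrable_const _)
            (ae_of_all _ hpt)
      _ = Ch ^ 4 := by rw [integral_const, probReal_univ, one_smul]
  have hLLN := chain_blockAverage_abs_sub_integral_le κ μ₀ hΨm hΨd hΨb hmean hV ha
  simp only [add_zero, sub_zero] at hLLN
  exact hLLN

end Summit.Ventures.LatticeQCDFlow.Scoring

end
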